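import Summits.Parity.GeneralizedHardyLittlewood.Theorems.PrimeLevelFamEdgeMomentsBeyondDiagonalLayersTermNormalForm
import Literature.NumberTheory.Sieve.DispersionAssemblyLemmas
import HarnessLib

/-!
# Route `PrimeLevelFamEdge`, crux K_A `MomentsBeyondDiagonal` (stmt-Parity-20007), line «petersson_layers» v4:
# the SHARP–FLAT REINDEXING of a separated form (assembly step E3, combinatorial part)

For a modulus `c ≥ 1` every `m ≥ 1` is uniquely `m = s·f` with `s = (m, c^∞)` (all primes of `s` divide `c`; the
«sharp» part, the tree's `DispersionAssembly.smoothComponent c m`) and `(f, c) = 1` (the «flat» part,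
`DispersionAssembly.roughComponent c m`).  This file turns that into FINITE-SUM REINDEXING identities:
* §1 `sum_Icc_eq_sum_sharp_flat`: `Σ_{m ≤ X} F(m) = Σ_{s ≤ X, s | c^∞} Σ_{f ≤ X/s, (f,c)=1} F(s f)`;
* §2 `sum_eight_reorder`: the bookkeeping reordering of the resulting eight-fold sum;
* §3 **`sum_four_eq_sum_sharp_classes`**: a four-variable form `Σ_{m₁≤X₁,n₁≤Y₁,m₂≤X₂,n₂≤Y₂} Φ(m₁,n₁,m₂,n₂)` is the
  sum over SHARP CLASSES `(s₁,t₁,s₂,t₂)` of the same form over the flats `(f₁,h₁,f₂,h₂)`, `(·, c) = 1`, at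
  `(s₁f₁, t₁h₁, s₂f₂, t₂h₂)` — the shape in which, class by class, `…LayersTermNormalForm.kloostermanSum_term_normal_form`
  turns the kernel `S(m₁n₁, m₂n₂; c)` of `stub_farP`'s `k = 0` forms (`…LayersFormReductionZero`) into a dilated Kloosterman
  sum in the flat products `f₁f₂`, `h₁h₂` with Pascadi's coprimality (remaining steps E3–E5 of the census: per-class
  bounds and the class count; NOT done here).
Proof only (def-free helper); no form is bounded here; K_A NOT proved; nothing about Landau–Siegel zeros.
-/

noncomputable section

open Finset
open Literature.NumberTheory.Sieve.DispersionAssembly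

namespace Summit.Parity.GeneralizedHardyLittlewood.Theorems.MomentsBeyondDiagonal.Layers

/-! ## §1. One variable -/

/-- The sharp part divides: `(m, c^∞) ≤ m` and `m/(m,c^∞) ≤ X/(m,c^∞)` for `1 ≤ m ≤ X`. [folklore] -/
theorem smoothComponent_mem_Icc {c m X : ℕ} (hm : m ∈ Icc 1 X) :
    smoothComponent c m ∈ Icc 1 X ∧ roughComponent c m ∈ Icc 1 (X / smoothComponent c m) := by
  have hm1 : 1 ≤ m := (mem_Icc.mp hm).1
  have hmX : m ≤ X := (mem_Icc.mp hm).2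
  have hm0 : m ≠ 0 := by omega
  have hprod := smoothComponent_mul_roughComponent c hm0
  have hs0 := smoothComponent_ne_zero c m
  have hr0 := roughComponent_ne_zero c m
  have hspos : 0 < smoothComponent c m := Nat.pos_of_ne_zero hs0
  refine ⟨mem_Icc.mpr ⟨hspos, ?_⟩, mem_Icc.mpr ⟨Nat.pos_of_ne_zero hr0, ?_⟩⟩
  · calc smoothComponent c m ≤ smoothComponent c m * roughComponent c m :=
          Nat.le_mul_of_pos_right _ (Nat.pos_of_ne_zero hr0)
      _ = m := hprod
      _ ≤ X := hmX
  · rw [Nat.le_div_iff_mul_le hspos, mul_comm, hprod]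
    exact hmX

/-- **Sharp–flat reindexing of one variable**: for `c ≠ 0`,
`Σ_{1 ≤ m ≤ X} F(m) = Σ_{1 ≤ s ≤ X, s | c^∞} Σ_{1 ≤ f ≤ X/s, (f, c) = 1} F(s·f)`. [folklore] -/
theorem sum_Icc_eq_sum_sharp_flat {M : Type*} [AddCommMonoid M] {c : ℕ} (hc : c ≠ 0) (X : ℕ) (F : ℕ → M) :
    ∑ m ∈ Icc 1 X, F m =
      ∑ s ∈ (Icc 1 X).filter (fun s ↦ s ∈ Nat.factoredNumbers c.primeFactors),
        ∑ f ∈ (Icc 1 (X / s)).filter (fun f ↦ Nat.Coprime f c), F (s * f) := by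
  rw [← Finset.sum_sigma ((Icc 1 X).filter (fun s ↦ s ∈ Nat.factoredNumbers c.primeFactors))
    (fun s ↦ (Icc 1 (X / s)).filter (fun f ↦ Nat.Coprime f c)) (fun p ↦ F (p.1 * p.2))]
  refine Finset.sum_nbij' (fun m ↦ (⟨smoothComponent c m, roughComponent c m⟩ : Σ _ : ℕ, ℕ))
    (fun p ↦ p.1 * p.2) ?_ ?_ ?_ ?_ ?_
  · intro m hm
    obtain ⟨hs, hf⟩ := smoothComponent_mem_Icc (c := c) hm
    simp only [mem_sigma, mem_filter]
    exact ⟨⟨hs, smoothComponent_mem_factoredNumbers hc m⟩, hf, roughComponent_coprime c m⟩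
  · rintro ⟨s, f⟩ hp
    simp only [mem_sigma, mem_filter, mem_Icc] at hp
    obtain ⟨⟨⟨hs1, hsX⟩, -⟩, ⟨hf1, hfX⟩, -⟩ := hp
    show s * f ∈ Icc 1 X
    refine mem_Icc.mpr ⟨Nat.one_le_iff_ne_zero.mpr (mul_ne_zero (by omega) (by omega)), ?_⟩
    calc s * f ≤ s * (X / s) := Nat.mul_le_mul_left s hfX
      _ ≤ X := Nat.mul_div_le X s
  · intro m hm
    have hm0 : m ≠ 0 := by have := (mem_Icc.mp hm).1; omega
    exact smoothComponent_mul_roughComponent c hm0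
  · rintro ⟨s, f⟩ hp
    simp only [mem_sigma, mem_filter, mem_Icc] at hp
    obtain ⟨⟨⟨hs1, -⟩, hsf⟩, ⟨hf1, -⟩, hfc⟩ := hp
    have hsf0 : s * f ≠ 0 := mul_ne_zero (by omega) (by omega)
    obtain ⟨h1, h2⟩ := smoothComponent_eq_of_mul_eq hc hsf0 hsf hfc rfl
    simp only [h1, h2]
  · intro m hm
    have hm0 : m ≠ 0 := by have := (mem_Icc.mp hm).1; omega
    simp only [smoothComponent_mul_roughComponent c hm0]

/-! ## §2. The bookkeeping reordering -/

/-- Reordering of the eight-fold sum `Σs₁ Σf₁ Σt₁ Σh₁ Σs₂ Σf₂ Σt₂ Σh₂ → Σs₁ Σt₁ Σs₂ Σt₂ Σf₁ Σh₁ Σf₂ Σh₂` (the flat ranges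
depend only on their own sharp variable). [folklore] -/
theorem sum_eight_reorder {M : Type*} [AddCommMonoid M] (A₁ A₂ A₃ A₄ : Finset ℕ) (R₁ R₂ R₃ R₄ : ℕ → Finset ℕ)
    (Ψ : ℕ → ℕ → ℕ → ℕ → ℕ → ℕ → ℕ → ℕ → M) :
    ∑ s₁ ∈ A₁, ∑ f₁ ∈ R₁ s₁, ∑ t₁ ∈ A₂, ∑ h₁ ∈ R₂ t₁, ∑ s₂ ∈ A₃, ∑ f₂ ∈ R₃ s₂, ∑ t₂ ∈ A₄, ∑ h₂ ∈ R₄ t₂,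
        Ψ s₁ f₁ t₁ h₁ s₂ f₂ t₂ h₂ =
      ∑ s₁ ∈ A₁, ∑ t₁ ∈ A₂, ∑ s₂ ∈ A₃, ∑ t₂ ∈ A₄, ∑ f₁ ∈ R₁ s₁, ∑ h₁ ∈ R₂ t₁, ∑ f₂ ∈ R₃ s₂, ∑ h₂ ∈ R₄ t₂,
        Ψ s₁ f₁ t₁ h₁ s₂ f₂ t₂ h₂ := by
  refine sum_congr rfl fun s₁ _ ↦ ?_
  -- step 1: `t₂` past `f₂`
  have e1 : ∀ f₁ t₁ h₁ s₂,
      ∑ f₂ ∈ R₃ s₂, ∑ t₂ ∈ A₄, ∑ h₂ ∈ R₄ t₂, Ψ s₁ f₁ t₁ h₁ s₂ f₂ t₂ h₂ =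
        ∑ t₂ ∈ A₄, ∑ f₂ ∈ R₃ s₂, ∑ h₂ ∈ R₄ t₂, Ψ s₁ f₁ t₁ h₁ s₂ f₂ t₂ h₂ := fun _ _ _ _ ↦ Finset.sum_comm
  simp_rw [e1]
  -- step 2: `(s₂, t₂)` past `h₁`
  have e2 : ∀ f₁ t₁,
      ∑ h₁ ∈ R₂ t₁, ∑ s₂ ∈ A₃, ∑ t₂ ∈ A₄, ∑ f₂ ∈ R₃ s₂, ∑ h₂ ∈ R₄ t₂, Ψ s₁ f₁ t₁ h₁ s₂ f₂ t₂ h₂ =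
        ∑ s₂ ∈ A₃, ∑ t₂ ∈ A₄, ∑ h₁ ∈ R₂ t₁, ∑ f₂ ∈ R₃ s₂, ∑ h₂ ∈ R₄ t₂, Ψ s₁ f₁ t₁ h₁ s₂ f₂ t₂ h₂ := by
    intro f₁ t₁
    rw [Finset.sum_comm]
    refine sum_congr rfl fun s₂ _ ↦ ?_
    rw [Finset.sum_comm]
  simp_rw [e2]
  -- step 3: `(t₁, s₂, t₂)` past `f₁`
  rw [Finset.sum_comm]
  refine sum_congr rfl fun t₁ _ ↦ ?_
  rw [Finset.sum_comm]
  refine sum_congr rfl fun s₂ _ ↦ ?_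
  rw [Finset.sum_comm]

/-! ## §3. Four variables: the sharp classes of a separated form -/

/-- **The sharp classes of a four-variable form** (`c ≠ 0`): with `Sh(X) = {1 ≤ s ≤ X : s | c^∞}` and
`Fl(Z) = {1 ≤ f ≤ Z : (f, c) = 1}`,
`Σ_{m₁≤X₁} Σ_{n₁≤Y₁} Σ_{m₂≤X₂} Σ_{n₂≤Y₂} Φ(m₁,n₁,m₂,n₂)
 = Σ_{s₁∈Sh X₁} Σ_{t₁∈Sh Y₁} Σ_{s₂∈Sh X₂} Σ_{t₂∈Sh Y₂} Σ_{f₁∈Fl(X₁/s₁)} Σ_{h₁∈Fl(Y₁/t₁)} Σ_{f₂∈Fl(X₂/s₂)} Σ_{h₂∈Fl(Y₂/t₂)}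
     Φ(s₁f₁, t₁h₁, s₂f₂, t₂h₂)`. [folklore] -/
theorem sum_four_eq_sum_sharp_classes {M : Type*} [AddCommMonoid M] {c : ℕ} (hc : c ≠ 0) (X₁ Y₁ X₂ Y₂ : ℕ)
    (Φ : ℕ → ℕ → ℕ → ℕ → M) :
    ∑ m₁ ∈ Icc 1 X₁, ∑ n₁ ∈ Icc 1 Y₁, ∑ m₂ ∈ Icc 1 X₂, ∑ n₂ ∈ Icc 1 Y₂, Φ m₁ n₁ m₂ n₂ =
      ∑ s₁ ∈ (Icc 1 X₁).filter (fun s ↦ s ∈ Nat.factoredNumbers c.primeFactors),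
      ∑ t₁ ∈ (Icc 1 Y₁).filter (fun s ↦ s ∈ Nat.factoredNumbers c.primeFactors),
      ∑ s₂ ∈ (Icc 1 X₂).filter (fun s ↦ s ∈ Nat.factoredNumbers c.primeFactors),
      ∑ t₂ ∈ (Icc 1 Y₂).filter (fun s ↦ s ∈ Nat.factoredNumbers c.primeFactors),
        ∑ f₁ ∈ (Icc 1 (X₁ / s₁)).filter (fun f ↦ Nat.Coprime f c),
        ∑ h₁ ∈ (Icc 1 (Y₁ / t₁)).filter (fun f ↦ Nat.Coprime f c),
        ∑ f₂ ∈ (Icc 1 (X₂ / s₂)).filter (fun f ↦ Nat.Coprime f c),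
        ∑ h₂ ∈ (Icc 1 (Y₂ / t₂)).filter (fun f ↦ Nat.Coprime f c),
          Φ (s₁ * f₁) (t₁ * h₁) (s₂ * f₂) (t₂ * h₂) := by
  rw [sum_Icc_eq_sum_sharp_flat hc X₁]
  simp_rw [sum_Icc_eq_sum_sharp_flat hc Y₁, sum_Icc_eq_sum_sharp_flat hc X₂, sum_Icc_eq_sum_sharp_flat hc Y₂]
  exact sum_eight_reorder _ _ _ _ _ _ _ _ (fun s₁ f₁ t₁ h₁ s₂ f₂ t₂ h₂ ↦ Φ (s₁ * f₁) (t₁ * h₁) (s₂ * f₂) (t₂ * h₂))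

end Summit.Parity.GeneralizedHardyLittlewood.Theorems.MomentsBeyondDiagonal.Layers

end
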